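import Summits.ResolutionOfSingularities.ResolutionOfSingularities.Theorems.HilbertSamuelEliminationCampaignW42RidgeConeBlowup
import Summits.ResolutionOfSingularities.ResolutionOfSingularities.Theorems.HilbertSamuelEliminationCampaignW42ConeHilbertSamuel
import Summits.ResolutionOfSingularities.ResolutionOfSingularities.Theorems.HilbertSamuelEliminationCampaignW42RidgeConfinementLocal
import HarnessLib

/-!
# [OURS · L1 W4.2] Ridge confinement for the blow-up of the vertex of a cone: the strict transform ideal
# is generated by the tree's proper transforms, and the local-ring (CJS Def. 3.13) form of the confinement
# (campaign s42 of cell res-hironaka, LADDER-RESOLUTION rung L; informal crux `RidgeConfinement`,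
# stmt-ResolutionOfSingularities-17845; `--supports`)

HONEST FRAMING. OURS (slot W4.2, prover res-L1-s42-pv-1, gen 2): two complements to
`…CampaignW42RidgeConeBlowup.lean` (near `K`-rational points of the exceptional divisor of `Bl_0 C` =
`K`-points of `ℙ(F(C))`, for an arbitrary cone `C = V(I)`). Classical mathematics read in the chart model;
NOTHING here is a statement of H. Hironaka's manuscript [Hironaka2017]. AI review is weaker than expert
review.

* `coordProperTransform_univ_eq_dehomog` — for a nonzero form `f`, the tree's proper transform under the
  blow-up of the origin (`Resolution.coordProperTransform K univ j`, Hu's `f_𝔙 = π*f / ζ^l`, with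
  `Resolution.centreOrder univ f = deg f`) IS `f(X_j := 1) = CampaignW42.dehomog K j f`; hence
  `map_dehomog_eq_span_coordProperTransform`: **the strict transform ideal `I.map (dehomog K j)` of a
  homogeneous ideal is the ideal generated by the proper transforms of the forms of `I`** — the ideal used
  in `…RidgeConeBlowup.lean` is the tree's strict transform.
* `add_single_mem_ridge_iff_hilbertSamuelFun_eq`, `add_single_mem_ridge_iff_hilbertFun_eq` — **the
  confinement in the vocabulary of CJS §2.2 / Def. 3.13**: with `𝒪_{C',x'}` any localization of `S/J`
  at the rational point `x' = b` (`b_j = 0`) of the exceptional divisor and `𝒪_{C,0}` any localization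
  of `S/I` at the vertex, `b + e_j ∈ F(C)(K) ↔ H⁽¹⁾(𝒪_{C',x'}) = H⁽¹⁾(𝒪_{C,0}) ↔ H⁽⁰⁾(𝒪_{C',x'}) = H⁽⁰⁾(𝒪_{C,0})`
  (`x'` NEAR, CJS Def. 3.13, for points of the same dimension), and `hilbertSamuelFun_strictTransform_le`:
  `H⁽¹⁾(𝒪_{C',x'}) ≤ H⁽¹⁾(𝒪_{C,0})` (CJS Thm. 3.10 (1) in the model).

References (orientation only): V. Cossart, U. Jannsen, S. Saito, LNM 2270 (2020), §2.2, Thm. 3.10,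
Def. 3.13, Rem. 18.29; J. Giraud, Ann. Sci. ÉNS 8 (1975) §1.5; Y. Hu (2025) §5 Def. 5.4 (the tree's
`coordProperTransform`).
-/

noncomputable section

-- single-conjunct summit: the doubled namespace component `ResolutionOfSingularities` is mandated
set_option linter.dupNamespace false

open MvPolynomial Module IsLocalRing
open Literature.RingTheory.HilbertSamuel
open Literature.AlgebraicGeometry.Resolution

namespace Summit.ResolutionOfSingularities.ResolutionOfSingularities.Theorems

namespace CampaignW42

universe u

variable {K : Type u} [Field K] {n : ℕ}

/-! ## The strict transform ideal is generated by the tree's proper transforms -/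

/-- For a nonzero form `f`, `f(X_j := 1)` is not divisible by `X_j`. [folklore] -/
theorem dehomog_not_mem_span_X {j : Fin n} {f : MvPolynomial (Fin n) K} {d : ℕ} (hf : f.IsHomogeneous d)
    (hf0 : f ≠ 0) : dehomog K j f ∉ Ideal.span {(X j : MvPolynomial (Fin n) K)} := by
  intro hmem
  obtain ⟨h, hh⟩ := Ideal.mem_span_singleton'.mp hmem
  have h0 : dehomog K j f = 0 := by
    rw [← fibreRestrict_univ_dehomog K j f, ← hh, map_mul, fibreRestrict_X_self, mul_zero]
  exact hf0 (eq_of_dehomog_eq_of_isHomogeneous K j hf (isHomogeneous_zero _ _ d) (by rw [h0, map_zero]))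

/-- **The tree's proper transform of a nonzero form `f` of degree `d` under the blow-up of the origin is
`f(X_j := 1)`**, and its order along the centre is `d`: `Resolution.centreOrder univ f = d`,
`Resolution.coordProperTransform K univ j f = dehomog K j f`. [folklore] -/
theorem coordProperTransform_univ_eq_dehomog (j : Fin n) {f : MvPolynomial (Fin n) K} {d : ℕ}
    (hf : f.IsHomogeneous d) (hf0 : f ≠ 0) :
    centreOrder (Set.univ : Set (Fin n)) f = d ∧ coordProperTransform K Set.univ j f = dehomog K j f := by
  obtain ⟨h1, h2⟩ := eq_centreOrder_and_eq_coordProperTransform K Set.univ j (Set.mem_univ j) hf0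
    (dehomog_not_mem_span_X hf hf0) (coordBlowupSubst_univ_eq_of_isHomogeneous j hf)
  exact ⟨h1.symm, h2.symm⟩

/-- **`I.map (dehomog K j)` is the ideal generated by the proper transforms of the forms of `I`** (for a
homogeneous ideal `I`): the strict transform ideal of `…RidgeConeBlowup.lean` in the tree's vocabulary.
[folklore] -/
theorem map_dehomog_eq_span_coordProperTransform {I : Ideal (MvPolynomial (Fin n) K)}
    (hI : IsHomogeneousIdeal I) (j : Fin n) :
    I.map (dehomog K j) = Ideal.span ((coordProperTransform K Set.univ j) ''
      {f | f ∈ I ∧ ∃ d : ℕ, f.IsHomogeneous d}) := by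
  refine le_antisymm ?_ ?_
  · rw [Ideal.map_le_iff_le_comap]
    intro f hf
    rw [Ideal.mem_comap, ← sum_homogeneousComponent f, map_sum]
    refine Ideal.sum_mem _ fun e _ => ?_
    by_cases h0 : homogeneousComponent e f = 0
    · rw [h0, map_zero]
      exact Ideal.zero_mem _
    · rw [← (coordProperTransform_univ_eq_dehomog j (homogeneousComponent_isHomogeneous e f) h0).2]
      exact Ideal.subset_span ⟨_, ⟨hI f hf e, e, homogeneousComponent_isHomogeneous e f⟩, rfl⟩
  · rw [Ideal.span_le]
    rintro _ ⟨f, ⟨hfI, d, hfd⟩, rfl⟩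
    by_cases h0 : f = 0
    · rw [h0, coordProperTransform_zero]
      exact Ideal.zero_mem _
    · rw [SetLike.mem_coe, (coordProperTransform_univ_eq_dehomog j hfd h0).2]
      exact Ideal.mem_map_of_mem _ hfI

/-! ## The confinement in the Hilbert–Samuel vocabulary of CJS §2.2 / Def. 3.13 -/

section LocalRings

variable {I : Ideal (MvPolynomial (Fin n) K)} (hI : IsHomogeneousIdeal I) (j : Fin n) {b : Fin n → K}
  (hb : b j = 0)
  [((RingHom.ker (eval b)).map (Ideal.Quotient.mk (I.map (dehomog K j)))).IsMaximal]
  [((RingHom.ker (eval (0 : Fin n → K))).map (Ideal.Quotient.mk I)).IsMaximal]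
  (L' : Type u) [CommRing L'] [Algebra (MvPolynomial (Fin n) K ⧸ I.map (dehomog K j)) L'] [Algebra K L']
  [IsScalarTower K (MvPolynomial (Fin n) K ⧸ I.map (dehomog K j)) L']
  [IsLocalization.AtPrime L' ((RingHom.ker (eval b)).map (Ideal.Quotient.mk (I.map (dehomog K j))))]
  [IsLocalRing L'] [IsNoetherianRing L']
  (L₀ : Type u) [CommRing L₀] [Algebra (MvPolynomial (Fin n) K ⧸ I) L₀] [Algebra K L₀]
  [IsScalarTower K (MvPolynomial (Fin n) K ⧸ I) L₀]
  [IsLocalization.AtPrime L₀ ((RingHom.ker (eval (0 : Fin n → K))).map (Ideal.Quotient.mk I))]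
  [IsLocalRing L₀] [IsNoetherianRing L₀]

include hI hb in
/-- **CJS Thm. 3.10 (1) in the model, local rings**: `H⁽¹⁾(𝒪_{C',x'}) ≤ H⁽¹⁾(𝒪_{C,0})` pointwise for the
rational point `x' = b` (`b_j = 0`) of the exceptional divisor of the blow-up of the vertex of the cone
`C = V(I)`, `𝒪_{C',x'}` = any localization of `S/J` at `𝔪_b/J`, `𝒪_{C,0}` = any localization of `S/I` at
the vertex. [cite: CossartJannsenSaito2020, Thm. 3.10 (1)] -/
theorem hilbertSamuelFun_strictTransform_le : hilbertSamuelFun L' 1 ≤ hilbertSamuelFun L₀ 1 := by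
  intro d
  rw [hilbertSamuelFun_one_localization_cone_eq (I.map (dehomog K j)) b L' d,
    hilbertSamuelFun_one_localization_cone_eq I (0 : Fin n → K) L₀ d, ker_eval_zero]
  exact finrank_quotient_strictTransform_le hI j hb d

include hI hb in
/-- **Ridge confinement, local-ring form**: `x' = b` is NEAR to the vertex in the sense of CJS Def. 3.13
— `H⁽¹⁾(𝒪_{C',x'}) = H⁽¹⁾(𝒪_{C,0})` — iff its direction `b + e_j` lies in Giraud's ridge `F(C)(K)`.
[cite: Giraud1975, §1.5] -/
theorem add_single_mem_ridge_iff_hilbertSamuelFun_eq :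
    b + Pi.single j 1 ∈ ridge K I ↔ hilbertSamuelFun L' 1 = hilbertSamuelFun L₀ 1 := by
  rw [add_single_mem_ridge_iff_near hI j hb, funext_iff]
  refine forall_congr' fun d => ?_
  rw [hilbertSamuelFun_one_localization_cone_eq (I.map (dehomog K j)) b L' d,
    hilbertSamuelFun_one_localization_cone_eq I (0 : Fin n → K) L₀ d, ker_eval_zero]

include hI hb in
/-- The same with the Hilbert functions `H⁽⁰⁾` (`ν ↦ ν⁽¹⁾` is injective):
`b + e_j ∈ F(C)(K) ↔ H⁽⁰⁾(𝒪_{C',x'}) = H⁽⁰⁾(𝒪_{C,0})` (`= H(S/I)`,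
`hilbertFun_localization_vertex_eq_hilbertFunQuot`). [cite: Giraud1975, §1.5] -/
theorem add_single_mem_ridge_iff_hilbertFun_eq :
    b + Pi.single j 1 ∈ ridge K I ↔ hilbertFun L' = hilbertFun L₀ := by
  rw [add_single_mem_ridge_iff_hilbertSamuelFun_eq hI j hb L' L₀]
  exact (iterPSum_injective 1).eq_iff

end LocalRings

end CampaignW42

end Summit.ResolutionOfSingularities.ResolutionOfSingularities.Theorems
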